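import Literature.NumberTheory.Automorphic.HilbertRepKTypeMultiplicity
import Literature.NumberTheory.Automorphic.ProductGroupMultiplicityRep
import Literature.NumberTheory.Automorphic.ProductGroupTensorHomMultiplicity
import Literature.NumberTheory.Automorphic.CompactGroupCharacterProjectionIsotypic
import HarnessLib

/-!
# `Θ(τ)` is irreducible for an irreducible `U` of `G × H` — ANY groups `G`, `H`

Topic `Literature/NumberTheory/Automorphic` (`HilbertRepSpectrum` vocabulary); theorems only, no definition, no named fact.

`ProductGroupMultiplicityRep.isIrreducible_multiplicityRep` proved Bröcker–tom Dieck II (4.14) — for an irreducible `U` of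
`G × H` the multiplicity space `Θ(τ) = Hom_H(τ, U|_H)` is an irreducible `G`-module — for `H` COMPACT Hausdorff with `U|_H`
strongly continuous and `τ` norm-continuous, because the dimension count `dim Θ(τ) · dim τ = dim X_τ(U|_H)` came from the
character projection.  With the any-group count `finrank_isotypicComponent_eq_finrank_mul_finrank_intertwiners'`
(`HilbertRepKTypeMultiplicity`, from Schur orthogonality in `Hom_H(τ, ρ)`) the same argument works for ANY groups `G`, `H`,
with no topology and no continuity: `U` irreducible unitary on a finite-dimensional `X`, `τ` irreducible unitary.

* `isIrreducible_multiplicityRep'` — **`Θ(τ)` (operator-norm model `ContRepresentation.multiplicityRep`) is irreducible**;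
* `isIrreducible_homRep'`, `isTopIrreducible_homRep'` — the same for the Hilbert–Schmidt model `ContRepresentation.homRep`
  (`HilbertRepMultiplicitySpace`), algebraically and topologically.

## References
* T. Bröcker, T. tom Dieck, *Representations of Compact Lie Groups*, GTM 98 (1985), II Prop (4.14) and its proof, PDF p. 80
  [BrockerTomDieck1985].
* A. Deitmar, S. Echterhoff, *Principles of Harmonic Analysis*, 2nd ed. (2014), §7.3 Lemma 7.3.1, Thm. 7.3.2, PDF pp. 197–198
  [DeitmarEchterhoff2014].

## Provenance
Lane `lit-hodgefound` (HOME `run/shared/lean/pub/lit-hodgefound/`), prover seat `lit-hodgefound-p05` generation 7 (Layer 0,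
beneath C2-08 / C2-10).
-/

noncomputable section

open ContinuousLinearMap
open Literature.RepresentationTheory.CompactGroups Literature.NumberTheory.Automorphic
open scoped InnerProductSpace TensorProduct

namespace ContRepresentation

section Irreducible

variable {G H : Type*} [Group G] [Group H]
variable {X : Type*} [NormedAddCommGroup X] [InnerProductSpace ℂ X] [FiniteDimensional ℂ X]
variable {F : Type*} [NormedAddCommGroup F] [InnerProductSpace ℂ F] [FiniteDimensional ℂ F]
variable {U : ContRepresentation ℂ (G × H) X} {τ : ContRepresentation ℂ H F}

/-- **For an irreducible unitary `U` of `G × H` (ANY groups) on a finite-dimensional space, a non-zero multiplicity space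
`Θ(τ) = Hom_H(τ, U|_H)` is an irreducible representation of `G`** — Bröcker–tom Dieck II (4.14), proof («decompose
`Hom_H(W_j, U) = ⊕_i n_ij V_i` as a `G`-module … `U ≅ ⊕ n_ij V_i ⊗ W_j`»): a `G`-invariant `P ⊆ Θ(τ)` spans the
`G × H`-invariant `ev(P ⊗ V_τ) ⊆ X`, which is `0` only if `P = 0` and everything only if
`dim P · dim τ ≥ dim X = dim X_τ(U|_H) = dim Θ(τ) · dim τ` (`finrank_isotypicComponent_eq_finrank_mul_finrank_intertwiners'`,
any group). [cite: BrockerTomDieck1985, II Prop (4.14)] -/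
theorem isIrreducible_multiplicityRep' (hUu : ∀ (gh : G × H) (x y : X), ⟪U gh x, U gh y⟫_ℂ = ⟪x, y⟫_ℂ)
    [U.toRepresentation.IsIrreducible] [τ.toRepresentation.IsIrreducible]
    (hτu : ∀ (h : H) (v w : F), ⟪τ h v, τ h w⟫_ℂ = ⟪v, w⟫_ℂ)
    [Nontrivial (Schur.intertwiners τ (U.restrict (MonoidHom.inr G H)))] :
    (U.multiplicityRep τ).toRepresentation.IsIrreducible := by
  classical
  haveI : CompleteSpace X := FiniteDimensional.complete ℂ X
  haveI : Nontrivial F := IsSimpleModule.nontrivial (MonoidAlgebra ℂ H) τ.toRepresentation.asModule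
  set ρ : ContRepresentation ℂ H X := U.restrict (MonoidHom.inr G H) with hρ
  have hU : U.IsUnitary := ContRepresentation.isUnitary_iff_inner_map_map.mpr hUu
  have hρu : ρ.IsUnitary := fun h => hU (MonoidHom.inr G H h)
  haveI hΘfin : FiniteDimensional ℂ (Schur.intertwiners τ ρ) :=
    (finiteDimensional_intertwiners_iff hρu hτu).mpr inferInstance
  -- the evaluation map `ev : Θ ⊗ V_τ → X`
  set ev : Schur.intertwiners τ ρ ⊗[ℂ] F →ₗ[ℂ] X :=
    TensorProduct.lift ((ContinuousLinearMap.coeLM ℂ).comp (Schur.intertwiners τ ρ).subtype) with hev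
  have hev_tmul : ∀ (T : Schur.intertwiners τ ρ) (f : F), ev (T ⊗ₜ[ℂ] f) = (T : F →L[ℂ] X) f := fun T f => by
    rw [hev, lift_eval_tmul]
  haveI : Nontrivial (Subrepresentation (U.multiplicityRep τ).toRepresentation) :=
    ⟨⟨⊥, ⊤, fun hbt => bot_ne_top
      (congrArg Subrepresentation.toSubmodule hbt : (⊥ : Submodule ℂ (Schur.intertwiners τ ρ)) = ⊤)⟩⟩
  refine ⟨fun P => ?_⟩
  letI : AddCommGroup P.toSubmodule := P.toSubmodule.addCommGroup
  letI : Module ℂ P.toSubmodule := P.toSubmodule.module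
  haveI : Module.Free ℂ P.toSubmodule := Module.Free.of_divisionRing ℂ _
  haveI : FiniteDimensional ℂ P.toSubmodule := FiniteDimensional.finiteDimensional_submodule _
  -- the `G × H`-invariant subspace `ev (P ⊗ V_τ)`
  set ι : P.toSubmodule ⊗[ℂ] F →ₗ[ℂ] Schur.intertwiners τ ρ ⊗[ℂ] F :=
    TensorProduct.map P.toSubmodule.subtype LinearMap.id with hι
  have hι_tmul : ∀ (p : P.toSubmodule) (f : F), ι (p ⊗ₜ[ℂ] f) = (p : Schur.intertwiners τ ρ) ⊗ₜ[ℂ] f :=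
    fun p f => rfl
  have hcomm : ∀ gh : G × H, (ev ∘ₗ ι) ∘ₗ TensorProduct.map (P.toRepresentation gh.1) (τ gh.2 : F →ₗ[ℂ] F) =
      (U gh : X →ₗ[ℂ] X) ∘ₗ (ev ∘ₗ ι) := by
    rintro ⟨g, h⟩
    refine TensorProduct.ext' fun p f => ?_
    simp only [LinearMap.comp_apply, TensorProduct.map_tmul, ContinuousLinearMap.coe_coe]
    rw [hι_tmul, hι_tmul, hev_tmul, hev_tmul]
    exact multiplicityRep_apply_apply_apply g h (p : Schur.intertwiners τ ρ) f
  let Q : Subrepresentation U.toRepresentation :=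
    { toSubmodule := LinearMap.range (ev ∘ₗ ι)
      apply_mem_toSubmodule := by
        rintro gh _ ⟨y, rfl⟩
        refine ⟨TensorProduct.map (P.toRepresentation gh.1) (τ gh.2 : F →ₗ[ℂ] F) y, ?_⟩
        exact LinearMap.congr_fun (hcomm gh) y }
  rcases IsSimpleOrder.eq_bot_or_eq_top Q with hQ | hQ
  · -- `ev (P ⊗ V_τ) = 0` forces `P = 0`
    left
    apply Subrepresentation.toSubmodule_injective
    change P.toSubmodule = ⊥
    rw [Submodule.eq_bot_iff]
    intro p hp
    apply Subtype.ext
    refine ContinuousLinearMap.ext fun f => ?_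
    have hmem : ((p : Schur.intertwiners τ ρ) : F →L[ℂ] X) f ∈ Q.toSubmodule :=
      ⟨⟨p, hp⟩ ⊗ₜ[ℂ] f, by rw [LinearMap.comp_apply, hι_tmul, hev_tmul]⟩
    rw [hQ] at hmem
    change ((p : Schur.intertwiners τ ρ) : F →L[ℂ] X) f ∈ (⊥ : Submodule ℂ X) at hmem
    rw [Submodule.mem_bot] at hmem
    rw [hmem]
    rfl
  · -- `ev (P ⊗ V_τ) = X` forces `dim P ≥ dim Θ(τ)`
    right
    apply Subrepresentation.toSubmodule_injective
    change P.toSubmodule = ⊤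
    have hQ' : LinearMap.range (ev ∘ₗ ι) = ⊤ := congrArg Subrepresentation.toSubmodule hQ
    have hrange : LinearMap.range (ev ∘ₗ ι) ≤ (ρ.isotypicComponent τ).toSubmodule :=
      (LinearMap.range_comp_le_range ι ev).trans (range_lift_eval_le_isotypicComponent hρu hτu)
    have htop : (ρ.isotypicComponent τ).toSubmodule = ⊤ := top_le_iff.mp (hQ' ▸ hrange)
    have h1 : Module.finrank ℂ X ≤ Module.finrank ℂ P.toSubmodule * Module.finrank ℂ F := by
      rw [← Module.finrank_tensorProduct, ← finrank_top ℂ X, ← hQ']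
      exact LinearMap.finrank_range_le (ev ∘ₗ ι)
    have h2 : Module.finrank ℂ (Schur.intertwiners τ ρ) * Module.finrank ℂ F = Module.finrank ℂ X := by
      rw [mul_comm, ← finrank_isotypicComponent_eq_finrank_mul_finrank_intertwiners' hρu hτu, htop, finrank_top]
    have h3 : Module.finrank ℂ (Schur.intertwiners τ ρ) ≤ Module.finrank ℂ P.toSubmodule :=
      Nat.le_of_mul_le_mul_right (h2 ▸ h1) Module.finrank_pos
    exact Submodule.eq_top_of_finrank_eq (le_antisymm (Submodule.finrank_le _) h3)

/-- **`Θ(τ)` in the Hilbert–Schmidt model (`ContRepresentation.homRep`) is irreducible** for an irreducible unitary `U` of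
ANY `G × H` on a finite-dimensional space and an irreducible unitary `τ` (`Θ(τ) ≠ 0`). [cite: BrockerTomDieck1985, II Prop (4.14)] -/
theorem isIrreducible_homRep' (hUu : ∀ (gh : G × H) (x y : X), ⟪U gh x, U gh y⟫_ℂ = ⟪x, y⟫_ℂ)
    [U.toRepresentation.IsIrreducible] [τ.toRepresentation.IsIrreducible]
    (hτu : ∀ (h : H) (v w : F), ⟪τ h v, τ h w⟫_ℂ = ⟪v, w⟫_ℂ) [Nontrivial (HomSpace τ (U.restrict (MonoidHom.inr G H)))] :
    (U.homRep τ).toRepresentation.IsIrreducible := by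
  haveI : Nontrivial (Schur.intertwiners τ (U.restrict (MonoidHom.inr G H))) :=
    (inferInstance : Nontrivial (HomSpace τ (U.restrict (MonoidHom.inr G H))))
  rw [toRepresentation_homRep_eq]
  exact isIrreducible_multiplicityRep' hUu hτu

/-- Hence **`Θ(τ)` is topologically irreducible** (`HilbertRepSpectrum.IsTopIrreducible`), any groups.
[cite: BrockerTomDieck1985, II Prop (4.14)] -/
theorem isTopIrreducible_homRep' (hUu : ∀ (gh : G × H) (x y : X), ⟪U gh x, U gh y⟫_ℂ = ⟪x, y⟫_ℂ)
    [U.toRepresentation.IsIrreducible] [τ.toRepresentation.IsIrreducible]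
    (hτu : ∀ (h : H) (v w : F), ⟪τ h v, τ h w⟫_ℂ = ⟪v, w⟫_ℂ) [Nontrivial (HomSpace τ (U.restrict (MonoidHom.inr G H)))] :
    (U.homRep τ).IsTopIrreducible := by
  haveI : CompleteSpace X := FiniteDimensional.complete ℂ X
  have hU : U.IsUnitary := ContRepresentation.isUnitary_iff_inner_map_map.mpr hUu
  have hρu : (U.restrict (MonoidHom.inr G H)).IsUnitary := fun h => hU (MonoidHom.inr G H h)
  have hfin : FiniteDimensional ℂ (Schur.intertwiners τ (U.restrict (MonoidHom.inr G H))) :=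
    (finiteDimensional_intertwiners_iff hρu hτu).mpr inferInstance
  haveI : FiniteDimensional ℂ (HomSpace τ (U.restrict (MonoidHom.inr G H))) := hfin
  haveI := isIrreducible_homRep' hUu hτu
  exact isTopIrreducible_of_isIrreducible (U.homRep τ)

end Irreducible

end ContRepresentation

end
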